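import Summits.QuantumFields.YangMills.Theorems.AllWindowsColdBoxTiltMomentsThresholds
import Summits.QuantumFields.YangMills.Theorems.ColdBoxAllGroupsBoxFloorAllGroupsGaussSideD
import Mathlib.Algebra.Order.Chebyshev
import HarnessLib

/-!
# LINE-17 «hypercontractive second-order tilt expansion» on crux `AllWindowsColdBox.BoxMidWindowsSU22` (stmt-QuantumFields-24003):
# F(iii) of stub F `stub_gaussSideTerms` — preliminaries for the instantiation (STUB-PLAN-E §5 F(iii))

Small inputs of the F(iii) instantiation (`…GaussSideTiltTerm`): the eighth Gaussian moment of the quadratic surrogate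
(`integral_qObsD_pow_eight_le`: `∫ qObsD⁸ dγ ≤ 2027025·D⁸/256` when the Dirichlet variance is `≤ 1`), the `rpow`-to-power
conversion `le_pow_four_of_rpow_quarter_le`, the bookkeeping `domX_algebra` of the E(4) dominator's second moment, and the thresholds
`eventually_tiltTermThresholds` (`729K₁²(2H+3)¹²/β² ≤ 1`, `K₁(2H+3)⁶/β ≤ 1` eventually, `θ ≤ 1/16`).

No definition; standard axioms.  HONEST LABEL: helper lemmas toward one third of the OPEN registered stub F of one critic-PASSed line
on the R2ξ″ RECORD-rung crux 24003; no stub by name, no crux, rung or summit; the Yang–Mills mass gap is NOT proved by this file.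
-/

set_option autoImplicit false

noncomputable section

open MeasureTheory ProbabilityTheory Finset
open Literature.MathematicalPhysics.QuantumLattice
open Literature.MathematicalPhysics.QuantumFieldTheory
open Literature.MathematicalPhysics.QuantumFieldTheory.LatticeMaxwell
open Summit.QuantumFields.YangMills.Theorems.WeakCouplingRates
open Summit.QuantumFields.YangMills.Theorems.ColdBoxAllGroups
open Summit.QuantumFields.YangMills.Theorems.FreeEnergyLogCoefficient

namespace Summit.QuantumFields.YangMills.Theorems.AllWindowsColdBoxBoxMidLine

section Prelim

variable {H : ℕ}

/-- **Eighth moment of the quadratic surrogate**: `∫ qObsD⁸ dγ ≤ 2027025·D⁸/256` when the Dirichlet variance of the plaquette is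
`≤ 1` (`qObsD = ½Σ_c s_c²`, `(Σ_c s_c²)⁸ ≤ D⁷Σ_c s_c¹⁶`, `E s¹⁶ ≤ 15!! = 2027025`). -/
theorem integral_qObsD_pow_eight_le {D : ℕ} (p : Plaq 4) (hvar : ∫ s, dirCirc H p s ^ 2 ∂(boxDirichlet H) ≤ 1) :
    Integrable (fun t : TSpaceD H D => qObsD H D p t ^ 8) (gaussD H D) ∧
      ∫ t, qObsD H D p t ^ 8 ∂(gaussD H D) ≤ 2027025 * (D : ℝ) ^ 8 / 256 := by
  obtain ⟨hint, hle⟩ := integral_sum_dirCirc_pow_even_le_D (D := D) p hvar 8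
  have hdf : (((2 * 8 - 1).doubleFactorial : ℕ) : ℝ) = 2027025 := by norm_num [Nat.doubleFactorial]
  rw [hdf] at hle
  have hD0 : (0 : ℝ) ≤ (D : ℝ) := Nat.cast_nonneg _
  have hpt : ∀ t : TSpaceD H D, qObsD H D p t ^ 8 ≤ (D : ℝ) ^ 7 / 256 * ∑ c, dirCirc H p (t c) ^ (2 * 8) := by
    intro t
    have h := pow_sum_le_card_mul_sum_pow (s := (Finset.univ : Finset (Fin D))) (f := fun c => dirCirc H p (t c) ^ 2)
      (fun c _ => sq_nonneg _) 7
    simp only [Finset.card_univ, Fintype.card_fin] at h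
    have e8 : ∀ c, (dirCirc H p (t c) ^ 2) ^ (7 + 1) = dirCirc H p (t c) ^ (2 * 8) := fun c => by ring
    simp only [e8] at h
    have e2 : qObsD H D p t ^ 8 = 1 / 256 * (∑ c, dirCirc H p (t c) ^ 2) ^ (7 + 1) := by rw [qObsD]; ring
    rw [e2]
    have h256 : 1 / 256 * (∑ c, dirCirc H p (t c) ^ 2) ^ (7 + 1) ≤ 1 / 256 * ((D : ℝ) ^ 7 * ∑ c, dirCirc H p (t c) ^ (2 * 8)) :=
      mul_le_mul_of_nonneg_left h (by norm_num)
    linarith only [h256]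
  have hdom : Integrable (fun t : TSpaceD H D => (D : ℝ) ^ 7 / 256 * ∑ c, dirCirc H p (t c) ^ (2 * 8)) (gaussD H D) := hint.const_mul _
  have h8 : Integrable (fun t : TSpaceD H D => qObsD H D p t ^ 8) (gaussD H D) :=
    hdom.mono' ((ColdBoxAllGroups.measurable_qObsD D p).pow_const 8).aestronglyMeasurable (ae_of_all _ fun t => by
      rw [Real.norm_eq_abs, abs_of_nonneg (Even.pow_nonneg (by decide) _)]; exact hpt t)
  refine ⟨h8, (integral_mono h8 hdom hpt).trans ?_⟩
  rw [integral_const_mul]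
  have h1 : (D : ℝ) ^ 7 / 256 * ∫ t, ∑ c, dirCirc H p (t c) ^ (2 * 8) ∂(gaussD H D) ≤ (D : ℝ) ^ 7 / 256 * ((D : ℝ) * 2027025) :=
    mul_le_mul_of_nonneg_left hle (by positivity)
  refine h1.trans (le_of_eq ?_); ring

/-- From an `L⁴`-norm bound in `rpow` form to the fourth-moment bound: `(I)^{1/4} ≤ K`, `0 ≤ I` `⇒ I ≤ K⁴`. -/
theorem le_pow_four_of_rpow_quarter_le {I K : ℝ} (hI : 0 ≤ I) (h : I ^ (1 / 4 : ℝ) ≤ K) : I ≤ K ^ 4 := by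
  have h0 : 0 ≤ I ^ (1 / 4 : ℝ) := Real.rpow_nonneg hI _
  have e : (I ^ (1 / 4 : ℝ)) ^ 4 = I := by
    rw [← Real.rpow_natCast, ← Real.rpow_mul hI]; norm_num
  calc I = (I ^ (1 / 4 : ℝ)) ^ 4 := e.symm
    _ ≤ K ^ 4 := pow_le_pow_left₀ h0 h 4

/-- Bookkeeping for the dominator `X = X₂ + X₃` of `tiltWE − tiltCubicW`: with `#E_f ≤ 4(2Hr+3)⁴ ≤ 2500Hr⁴`,
`2·(13440β)²·(105D⁴#E_f²(16Hr)⁴/β⁴) + 2·(2C₂)²·(3D²#E_f²(16Hr)²/β²) ≤ CX·Hr¹²/β²`. -/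
theorem domX_algebra {β Hr NE D C₂ : ℝ} (hβ : 0 < β) (hH : 1 ≤ Hr) (hNE0 : 0 ≤ NE) (hNE : NE ≤ 4 * (2 * Hr + 3) ^ 4) :
    2 * ((13440 * β) ^ 2 * (105 * D ^ 4 * NE ^ 2 * (16 * Hr) ^ 4 / β ^ 4)) + 2 * ((2 * C₂) ^ 2 * (3 * D ^ 2 * NE ^ 2 * (16 * Hr) ^ 2 / β ^ 2)) ≤
      (2 * 13440 ^ 2 * 105 * D ^ 4 * 2500 ^ 2 * 16 ^ 4 + 2 * 4 * C₂ ^ 2 * 3 * D ^ 2 * 2500 ^ 2 * 16 ^ 2) * Hr ^ 12 / β ^ 2 := by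
  have hH0 : 0 ≤ Hr := by linarith
  have h5 : 2 * Hr + 3 ≤ 5 * Hr := by linarith
  have hNE' : NE ≤ 2500 * Hr ^ 4 := by
    refine hNE.trans ?_
    have := pow_le_pow_left₀ (by linarith : 0 ≤ 2 * Hr + 3) h5 4
    nlinarith [this]
  have hNE2 : NE ^ 2 ≤ (2500 * Hr ^ 4) ^ 2 := pow_le_pow_left₀ hNE0 hNE' 2
  have hH10 : Hr ^ 10 ≤ Hr ^ 12 := pow_le_pow_right₀ hH (by norm_num)
  have e1 : 2 * ((13440 * β) ^ 2 * (105 * D ^ 4 * NE ^ 2 * (16 * Hr) ^ 4 / β ^ 4)) =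
      (2 * 13440 ^ 2 * 105 * 16 ^ 4) * D ^ 4 * (NE ^ 2 * Hr ^ 4) / β ^ 2 := by
    field_simp
  have e2 : 2 * ((2 * C₂) ^ 2 * (3 * D ^ 2 * NE ^ 2 * (16 * Hr) ^ 2 / β ^ 2)) =
      (2 * 4 * 3 * 16 ^ 2) * C₂ ^ 2 * D ^ 2 * (NE ^ 2 * Hr ^ 2) / β ^ 2 := by
    field_simp; ring
  rw [e1, e2, ← add_div]
  refine div_le_div_of_nonneg_right ?_ (by positivity)
  have hA : NE ^ 2 * Hr ^ 4 ≤ 2500 ^ 2 * Hr ^ 12 := by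
    calc NE ^ 2 * Hr ^ 4 ≤ (2500 * Hr ^ 4) ^ 2 * Hr ^ 4 := mul_le_mul_of_nonneg_right hNE2 (by positivity)
      _ = 2500 ^ 2 * Hr ^ 12 := by ring
  have hB : NE ^ 2 * Hr ^ 2 ≤ 2500 ^ 2 * Hr ^ 12 := by
    calc NE ^ 2 * Hr ^ 2 ≤ (2500 * Hr ^ 4) ^ 2 * Hr ^ 2 := mul_le_mul_of_nonneg_right hNE2 (by positivity)
      _ = 2500 ^ 2 * Hr ^ 10 := by ring
      _ ≤ 2500 ^ 2 * Hr ^ 12 := mul_le_mul_of_nonneg_left hH10 (by norm_num)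
  have h1 := mul_le_mul_of_nonneg_left hA (by positivity : (0 : ℝ) ≤ (2 * 13440 ^ 2 * 105 * 16 ^ 4) * D ^ 4)
  have h2 := mul_le_mul_of_nonneg_left hB (by positivity : (0 : ℝ) ≤ (2 * 4 * 3 * 16 ^ 2) * C₂ ^ 2 * D ^ 2)
  nlinarith [h1, h2]

/-- The F(iii) thresholds (eventually in `β`, `0 < θ ≤ 1/16`): `1 ≤ β`, the cubic-chaos moments are `≤ 1`
(`729K₁²(2Hr+3)¹²/β² ≤ 1`, `K₁(2Hr+3)⁶/β ≤ 1`). -/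
theorem eventually_tiltTermThresholds {θ : ℝ} (hθ : 0 < θ) (hθ16 : θ ≤ 1 / 16) (K₁ : ℝ) :
    ∃ β₀ : ℝ, ∀ β : ℝ, β₀ ≤ β → 1 ≤ β ∧ 729 * K₁ ^ 2 * (2 * (⌈β ^ θ⌉₊ : ℝ) + 3) ^ 12 / β ^ 2 ≤ 1 ∧
      K₁ * (2 * (⌈β ^ θ⌉₊ : ℝ) + 3) ^ 6 / β ≤ 1 := by
  obtain ⟨b₁, hb₁, m₁⟩ := eventually_monomial_le_one (729 * K₁ ^ 2) 12 hθ (a := -2) (by push_cast; linarith)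
  obtain ⟨b₂, -, m₂⟩ := eventually_monomial_le_one K₁ 6 hθ (a := -1) (by push_cast; linarith)
  refine ⟨max b₁ b₂, fun β hβ => ?_⟩
  have hβ1 : 1 ≤ β := hb₁.trans ((le_max_left _ _).trans hβ)
  have hβ0 : 0 < β := by linarith
  have k₁ := m₁ β ((le_max_left _ _).trans hβ)
  have k₂ := m₂ β ((le_max_right _ _).trans hβ)
  have hi2 : β ^ (-2 : ℝ) = (β ^ 2)⁻¹ := by rw [Real.rpow_neg hβ0.le, Real.rpow_two]
  have hi1 : β ^ (-1 : ℝ) = β⁻¹ := Real.rpow_neg_one β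
  rw [hi2, ← div_eq_mul_inv] at k₁
  rw [hi1, ← div_eq_mul_inv] at k₂
  exact ⟨hβ1, k₁, k₂⟩

end Prelim

end Summit.QuantumFields.YangMills.Theorems.AllWindowsColdBoxBoxMidLine

end
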